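import Literature.AlgebraicGeometry.Resolution.WeightedCentreEigenCosetLift
import Literature.AlgebraicGeometry.Resolution.WeightedCentreEigenClimb
import Literature.AlgebraicGeometry.Resolution.WeightedCentreOrderFiltration

/-!
# Eigen-coset lifting along the order filtration of `RingAut S` (engine 1's `W(f)` toy model, target T101 — an instrument, NOT a resolution theorem)

Glue of `WeightedCentreOrderFiltration` ((F1)–(F3), (F5)) with `WeightedCentreEigenCosetLift` (STEP 2 of the EIGEN-LIFT LEMMA,
RE-DERIVATION-eng1-g43 §3.2): for a subgroup `H` of automorphisms of a characteristic-`p` ring `S` fixing `r` and `≡ id (mod r)`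
(`H ≤ level r 1`), an endomorphism `s` of `H` acting on the graded piece `H ∩ 𝔄_m / H ∩ 𝔄_{m+1}` as the scalar `la m` for every `m`, and
non-resonant levels `a ≤ m < b` (`p ∤ la m - n₀`), an approximate eigen-element `s x = x ^ n₀ * h`, `h ∈ 𝔄_a`, improves to
`s (x g) = (x g) ^ n₀ * h'` with `g ∈ H ∩ 𝔄_a`, `h' ∈ H ∩ 𝔄_b` (`lift_levels`); and the uniqueness twin CLIMB
(`WeightedCentreEigenClimb`, CARVER-NOTES-eng1-g44 §2 T108): an exact eigen-element `Φ` and an approximate one `x` with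
`Φ⁻¹ x ∈ H ∩ 𝔄_a` satisfy `Φ⁻¹ x ∈ H ∩ 𝔄_t` (`climb_levels`, `climb_levels_exact`).  The commutator and exponent hypotheses of the
abstract lemmas are DISCHARGED here by (F2) and (F5) (`commutator_mem_levelIn_succ`, `pow_mem_levelIn_succ`); only the scalar
action (F4) (`hs`) remains for the toy-model instance (`s = s_{μ₀}`, `la m = μ₀^m`).
-/

namespace Literature.AlgebraicGeometry.Resolution.WeightedBlowup.EigenLiftLevels

open OrderFiltration

variable {S : Type*} [CommRing S]

/-- The order filtration restricted to a subgroup `H ≤ RingAut S`: `F m = H ∩ 𝔄_m` as subgroups of `H` (bookkeeping). [cite: Lang2002, Ch. I §3] -/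
def levelIn (r : S) (H : Subgroup (S ≃+* S)) (m : ℕ) : Subgroup H := (level r m).comap H.subtype

/-- Membership in `levelIn` is membership of the underlying automorphism in `level` (bookkeeping). [cite: Lang2002, Ch. I §3] -/
theorem mem_levelIn {r : S} {H : Subgroup (S ≃+* S)} {m : ℕ} {n : H} : n ∈ levelIn r H m ↔ (n : S ≃+* S) ∈ level r m := Iff.rfl

/-- `levelIn r H` is a descending chain ((F1)). [cite: Lang2002, Ch. I §3] -/
theorem levelIn_antitone (r : S) (H : Subgroup (S ≃+* S)) : Antitone (levelIn r H) :=
  fun _ _ hab _ hn => level_antitone r hab hn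

/-- **(F2) in `H`**: `[H, H ∩ 𝔄_m] ⊆ H ∩ 𝔄_{m+1}` for `H ≤ 𝔄_1` (bookkeeping; the hypothesis `hcomm` of the abstract lemmas).
[cite: Lang2002, Ch. I §3; AbramovichTemkinWlodarczyk2024, §5.1 (p. 1575)] -/
theorem commutator_mem_levelIn_succ (r : S) (H : Subgroup (S ≃+* S)) (hH : H ≤ level r 1) (m : ℕ) (g : H) {n : H}
    (hn : n ∈ levelIn r H m) : g * n * g⁻¹ * n⁻¹ ∈ levelIn r H (m + 1) := by
  rw [mem_levelIn] at hn ⊢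
  simpa only [Subgroup.coe_mul, Subgroup.coe_inv] using commutator_mem_level_succ (hH g.2) hn

/-- **(F5) in `H`**: `x ^ p ∈ H ∩ 𝔄_{m+1}` for `x ∈ H ∩ 𝔄_m`, `char S = p`, `H ≤ 𝔄_1` (bookkeeping; the hypothesis `hexp` of the
abstract lemmas; for `m = 0` it is `H ≤ 𝔄_1`). [cite: Lang2002, Ch. I §§3, 6; AbramovichTemkinWlodarczyk2024, §5.1 (p. 1575)] -/
theorem pow_mem_levelIn_succ (p : ℕ) [CharP S p] (r : S) (H : Subgroup (S ≃+* S)) (hH : H ≤ level r 1) (m : ℕ) {n : H}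
    (hn : n ∈ levelIn r H m) : n ^ p ∈ levelIn r H (m + 1) := by
  rw [mem_levelIn] at hn ⊢
  rcases Nat.eq_zero_or_pos m with rfl | hm
  · simpa only [Subgroup.coe_pow] using hH (n ^ p).2
  · simpa only [Subgroup.coe_pow] using pow_char_mem_level_succ p hm hn

/-- **Eigen-coset lift along the order filtration** (RE-DERIVATION-eng1-g43 §3.2 STEP 2 in the automorphism-group packaging of §3.1;
instrument for engine 1's `W(f)` toy model, NOT a resolution theorem).  `H ≤ 𝔄_1`, `char S = p`; `s : H →* H` acts on `H ∩ 𝔄_m / H ∩ 𝔄_{m+1}`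
as the scalar `la m` (`hs`, the toy model's (F4)); levels `a ≤ m < b` non-resonant; then `s x = x ^ n₀ * h`, `h ∈ 𝔄_a`, lifts to
`s (x g) = (x g) ^ n₀ * h'`, `g ∈ H ∩ 𝔄_a`, `h' ∈ H ∩ 𝔄_b`. [cite: Lang2002, Ch. I §§3, 6; AbramovichTemkinWlodarczyk2024, §5.1 (p. 1575)] -/
theorem lift_levels (p : ℕ) [Fact p.Prime] [CharP S p] (r : S) (H : Subgroup (S ≃+* S)) (hH : H ≤ level r 1) (s : H →* H)
    (n₀ : ℤ) (la : ℕ → ℤ) (hs : ∀ m, ∀ n ∈ levelIn r H m, s n * (n ^ la m)⁻¹ ∈ levelIn r H (m + 1)) {a b : ℕ}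
    (hab : a ≤ b) (hla : ∀ m, a ≤ m → m < b → ¬ (p : ℤ) ∣ la m - n₀) {x h : H} (hh : h ∈ levelIn r H a)
    (hx : s x = x ^ n₀ * h) :
    ∃ g ∈ levelIn r H a, ∃ h' ∈ levelIn r H b, s (x * g) = (x * g) ^ n₀ * h' :=
  EigenCosetLift.lift_filtration s p n₀ (levelIn r H) (levelIn_antitone r H)
    (fun m g _ hn => commutator_mem_levelIn_succ r H hH m g hn) (fun m _ hn => pow_mem_levelIn_succ p r H hH m hn) la hs
    hab hla hh hx

/-- The terminal case (`H ∩ 𝔄_b = {1}`, e.g. `b = p + 2` in the toy model when `r ≥ 3`): an exact eigen-element `s x' = x' ^ n₀` in the coset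
`x (H ∩ 𝔄_a)`. [cite: Lang2002, Ch. I §§3, 6; AbramovichTemkinWlodarczyk2024, §5.1 (p. 1575)] -/
theorem lift_levels_exact (p : ℕ) [Fact p.Prime] [CharP S p] (r : S) (H : Subgroup (S ≃+* S)) (hH : H ≤ level r 1) (s : H →* H)
    (n₀ : ℤ) (la : ℕ → ℤ) (hs : ∀ m, ∀ n ∈ levelIn r H m, s n * (n ^ la m)⁻¹ ∈ levelIn r H (m + 1)) {a b : ℕ}
    (hab : a ≤ b) (hb : levelIn r H b = ⊥) (hla : ∀ m, a ≤ m → m < b → ¬ (p : ℤ) ∣ la m - n₀) {x h : H}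
    (hh : h ∈ levelIn r H a) (hx : s x = x ^ n₀ * h) :
    ∃ g ∈ levelIn r H a, s (x * g) = (x * g) ^ n₀ := by
  obtain ⟨g, hg, h', hh', h1⟩ := lift_levels p r H hH s n₀ la hs hab hla hh hx
  rw [hb, Subgroup.mem_bot] at hh'
  exact ⟨g, hg, by rw [h1, hh', mul_one]⟩

/-- **CLIMB along the order filtration** (CARVER-NOTES-eng1-g44 §2 T108 in the packaging of RE-DERIVATION-eng1-g44 §3.1; instrument for
engine 1's `W(f)` toy model, NOT a resolution theorem).  `H ≤ 𝔄_1`, `char S = p`, `s : H →* H` acts on `H ∩ 𝔄_m / H ∩ 𝔄_{m+1}` as the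
scalar `la m`, levels `a ≤ m < t` non-resonant: if `s Φ = Φ ^ n₀`, `s x = x ^ n₀ * h` with `h ∈ H ∩ 𝔄_t`, and `Φ⁻¹ x ∈ H ∩ 𝔄_a`, then
`Φ⁻¹ x ∈ H ∩ 𝔄_t` (the three instances: THEOREM A⁺ / THEOREM B with `2 ≤ r ≤ p - 1` in `𝔄_1`, and — over `k[σ]/(σ^p)` — THEOREM B with
`r = 1`). [cite: Lang2002, Ch. I §§3, 6; AbramovichTemkinWlodarczyk2024, §5.1 (p. 1575)] -/
theorem climb_levels (p : ℕ) [Fact p.Prime] [CharP S p] (r : S) (H : Subgroup (S ≃+* S)) (hH : H ≤ level r 1) (s : H →* H)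
    (n₀ : ℤ) (la : ℕ → ℤ) (hs : ∀ m, ∀ n ∈ levelIn r H m, s n * (n ^ la m)⁻¹ ∈ levelIn r H (m + 1)) {a t : ℕ}
    (hat : a ≤ t) (hla : ∀ m, a ≤ m → m < t → ¬ (p : ℤ) ∣ la m - n₀) {Φ x h : H} (hE : Φ⁻¹ * x ∈ levelIn r H a)
    (hh : h ∈ levelIn r H t) (hΦ : s Φ = Φ ^ n₀) (hx : s x = x ^ n₀ * h) : Φ⁻¹ * x ∈ levelIn r H t :=
  EigenClimb.climb s p n₀ (levelIn r H) (levelIn_antitone r H) (fun m g _ hn => commutator_mem_levelIn_succ r H hH m g hn)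
    (fun m _ hn => pow_mem_levelIn_succ p r H hH m hn) la hs hat hla hE hh hΦ hx

/-- The terminal case (`H ∩ 𝔄_t = {1}`, e.g. `t = p + 1` with `h = 1` read in `𝔄_1/𝔄_{p+1}`, or the truncated group with `𝔄̄_p = {1}`):
the approximate eigen-element IS the exact one, `x = Φ`. [cite: Lang2002, Ch. I §§3, 6; AbramovichTemkinWlodarczyk2024, §5.1 (p. 1575)] -/
theorem climb_levels_exact (p : ℕ) [Fact p.Prime] [CharP S p] (r : S) (H : Subgroup (S ≃+* S)) (hH : H ≤ level r 1)
    (s : H →* H) (n₀ : ℤ) (la : ℕ → ℤ) (hs : ∀ m, ∀ n ∈ levelIn r H m, s n * (n ^ la m)⁻¹ ∈ levelIn r H (m + 1)) {a t : ℕ}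
    (hat : a ≤ t) (ht : levelIn r H t = ⊥) (hla : ∀ m, a ≤ m → m < t → ¬ (p : ℤ) ∣ la m - n₀) {Φ x h : H}
    (hE : Φ⁻¹ * x ∈ levelIn r H a) (hh : h ∈ levelIn r H t) (hΦ : s Φ = Φ ^ n₀) (hx : s x = x ^ n₀ * h) : x = Φ :=
  EigenClimb.climb_exact s p n₀ (levelIn r H) (levelIn_antitone r H)
    (fun m g _ hn => commutator_mem_levelIn_succ r H hH m g hn) (fun m _ hn => pow_mem_levelIn_succ p r H hH m hn) la hs
    hat ht hla hE hh hΦ hx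

end Literature.AlgebraicGeometry.Resolution.WeightedBlowup.EigenLiftLevels
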